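import Summits.QuantumFields.QCD.Theorems.QuarksAsStableActionSmallHoppingDiamagnetismStokes

/-!
# Small-hopping diamagnetism (stmt-QuantumFields-9738): deficits and the quantitative Stokes bound

For a representation `ρ` by unitary `N × N` matrices, the *Frobenius length*
`δ g = √(2 · defect ρ g) = ‖1 - ρ g‖_F` is subadditive, conjugation and inversion invariant and
vanishes at `1`; feeding it to the algebraic Stokes theorem (`exists_stokes`) and applying
Cauchy–Schwarz gives, for every balanced word `w`,

* `wordDefect_le` : `Σ_x (N - Re tr ρ(hol V x w)) ≤ |w|⁴ · S(V)`,

where `S(V) = wilsonAction ρ V` is the Wilson action of `V` (all plaquettes of the torus), together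
with the elementary facts `defect_nonneg`, `wilsonAction_nonneg'`, `planeDefect_le_wilsonAction`.
-/

noncomputable section

namespace Summit.QuantumFields.QCD.Theorems.SmallHopping

open Literature.Probability.LatticeModels Literature.MathematicalPhysics.QuantumLattice
  Literature.MathematicalPhysics.QuantumFieldTheory Matrix
open scoped ComplexConjugate

variable {L N : ℕ} {G : Type*} [Group G] (ρ : G →* Matrix (Fin N) (Fin N) ℂ)

/-! ## Frobenius sums of squares -/

section Frobenius

/-- `Σ_{ij} ‖A_{ij}‖² = Re tr (Aᴴ A)`. -/
theorem sum_norm_sq_eq_re_trace (A : Matrix (Fin N) (Fin N) ℂ) :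
    ∑ i, ∑ j, ‖A i j‖ ^ 2 = (Aᴴ * A).trace.re := by
  rw [Matrix.trace, Finset.sum_comm]
  simp only [Matrix.diag, Matrix.mul_apply, Matrix.conjTranspose_apply, Complex.re_sum]
  refine Finset.sum_congr rfl fun j _ => Finset.sum_congr rfl fun i _ => ?_
  rw [Complex.star_def, ← Complex.normSq_eq_conj_mul_self, Complex.ofReal_re, Complex.normSq_eq_norm_sq]

/-- Right multiplication by a unitary preserves `Σ ‖·‖²`. -/
theorem sum_norm_sq_mul_unitary (A : Matrix (Fin N) (Fin N) ℂ) {u : Matrix (Fin N) (Fin N) ℂ}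
    (hu : u ∈ Matrix.unitaryGroup (Fin N) ℂ) :
    ∑ i, ∑ j, ‖(A * u) i j‖ ^ 2 = ∑ i, ∑ j, ‖A i j‖ ^ 2 := by
  have hu' : u * star u = 1 := Matrix.mem_unitaryGroup_iff.mp hu
  rw [Matrix.star_eq_conjTranspose] at hu'
  rw [sum_norm_sq_eq_re_trace, sum_norm_sq_eq_re_trace, Matrix.conjTranspose_mul,
    show uᴴ * Aᴴ * (A * u) = uᴴ * (Aᴴ * A) * u by simp only [Matrix.mul_assoc],
    Matrix.trace_mul_cycle, hu', Matrix.one_mul]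

/-- For a unitary `u`: `Σ ‖(1 - u)_{ij}‖² = 2 (N - Re tr u)`. -/
theorem sum_norm_sq_one_sub_unitary {u : Matrix (Fin N) (Fin N) ℂ}
    (hu : u ∈ Matrix.unitaryGroup (Fin N) ℂ) :
    ∑ i, ∑ j, ‖(1 - u) i j‖ ^ 2 = 2 * (N - u.trace.re) := by
  have hu' : star u * u = 1 := Matrix.mem_unitaryGroup_iff'.mp hu
  rw [Matrix.star_eq_conjTranspose] at hu'
  rw [sum_norm_sq_eq_re_trace, Matrix.conjTranspose_sub, Matrix.conjTranspose_one, Matrix.sub_mul,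
    Matrix.one_mul, Matrix.mul_sub, Matrix.mul_one, hu', Matrix.trace_sub, Matrix.trace_sub,
    Matrix.trace_sub, Matrix.trace_one, Matrix.trace_conjTranspose, Fintype.card_fin]
  simp only [Complex.sub_re, Complex.natCast_re, Complex.star_def, Complex.conj_re]
  try ring

/-- The triangle inequality for the Frobenius norm `√(Σ ‖·‖²)`. -/
theorem sqrt_sum_norm_sq_add_le (A B : Matrix (Fin N) (Fin N) ℂ) :
    Real.sqrt (∑ i, ∑ j, ‖(A + B) i j‖ ^ 2) ≤
      Real.sqrt (∑ i, ∑ j, ‖A i j‖ ^ 2) + Real.sqrt (∑ i, ∑ j, ‖B i j‖ ^ 2) := by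
  let e : Matrix (Fin N) (Fin N) ℂ → EuclideanSpace ℂ (Fin N × Fin N) :=
    fun M => WithLp.toLp 2 (fun ij => M ij.1 ij.2)
  have he : ∀ M, ‖e M‖ = Real.sqrt (∑ i, ∑ j, ‖M i j‖ ^ 2) := fun M => by
    rw [EuclideanSpace.norm_eq, Fintype.sum_prod_type]
  have hadd : e (A + B) = e A + e B := rfl
  rw [← he, ← he, ← he, hadd]
  exact norm_add_le _ _

end Frobenius

/-! ## The Frobenius length of a unitary representation -/

section Length

variable (hρ : ∀ g, ρ g ∈ Matrix.unitaryGroup (Fin N) ℂ)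
include hρ

/-- `2 · defect ρ g = Σ ‖(1 - ρ g)_{ij}‖²`. -/
theorem two_mul_defect_eq (g : G) : 2 * defect ρ g = ∑ i, ∑ j, ‖(1 - ρ g) i j‖ ^ 2 := by
  rw [sum_norm_sq_one_sub_unitary (hρ g), defect]

/-- Deficits are nonnegative for unitary `ρ`. -/
theorem defect_nonneg (g : G) : 0 ≤ defect ρ g := by
  have h := two_mul_defect_eq ρ hρ g
  have : 0 ≤ ∑ i, ∑ j, ‖(1 - ρ g) i j‖ ^ 2 := by positivity
  linarith

/-- Subadditivity of the Frobenius length `√(2 defect)`: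
`‖1 - ρ(gh)‖_F ≤ ‖1 - ρ g‖_F + ‖1 - ρ h‖_F` (from `1 - ab = (1 - a) b + (1 - b)` and unitarity). -/
theorem sqrt_defect_mul_le (g h : G) :
    Real.sqrt (2 * defect ρ (g * h)) ≤ Real.sqrt (2 * defect ρ g) + Real.sqrt (2 * defect ρ h) := by
  rw [two_mul_defect_eq ρ hρ, two_mul_defect_eq ρ hρ, two_mul_defect_eq ρ hρ, map_mul,
    show (1 : Matrix (Fin N) (Fin N) ℂ) - ρ g * ρ h = (1 - ρ g) * ρ h + (1 - ρ h) by noncomm_ring,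
    ← sum_norm_sq_mul_unitary (1 - ρ g) (hρ h)]
  exact sqrt_sum_norm_sq_add_le _ _

omit hρ in
/-- Conjugation invariance of the deficit (cyclicity of the trace). -/
theorem defect_conj (c g : G) : defect ρ (c * g * c⁻¹) = defect ρ g := by
  unfold defect
  rw [map_mul, map_mul, Matrix.trace_mul_cycle, ← map_mul, inv_mul_cancel, map_one, Matrix.one_mul]

/-- Inversion invariance of the deficit for unitary `ρ` (`ρ(g⁻¹) = ρ(g)ᴴ`). -/
theorem defect_inv (g : G) : defect ρ g⁻¹ = defect ρ g := by
  have hstar : star (ρ g) = ρ g⁻¹ :=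
    left_inv_eq_right_inv (Matrix.mem_unitaryGroup_iff'.1 (hρ g))
      (by rw [← map_mul, mul_inv_cancel, map_one])
  unfold defect
  rw [← hstar, Matrix.star_eq_conjTranspose, Matrix.trace_conjTranspose,
    Complex.star_def, Complex.conj_re]

omit hρ in
/-- The deficit vanishes at the identity. -/
theorem defect_one : defect ρ (1 : G) = 0 := by
  simp [defect, Matrix.trace_one]

/-! ## The quantitative Stokes bound -/

/-- **Pointwise Stokes bound with Cauchy–Schwarz.**  For a balanced word `w` there are `K ≤ |w|²`
(offset, plane) data such that for all `V`, `x`: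
`defect (hol V x w) ≤ K · Σ_k defect (plaquetteHolonomy V (x + o_k) μ_k ν_k)`. -/
theorem exists_defect_hol_le (w : List Letter) (hw : balanced w = true) :
    ∃ (K : ℕ) (o : Fin K → TorusSite 4 L) (pl : Fin K → Fin 4 × Fin 4), K ≤ w.length ^ 2 ∧
      ∀ (V : GaugeConfig 4 L G) (x : TorusSite 4 L),
        defect ρ (hol V x w) ≤
          K * ∑ k, defect ρ (plaquetteHolonomy V (x + o k) (pl k).1 (pl k).2) := by
  obtain ⟨P, hPlen, hP⟩ := exists_stokes (fun g => Real.sqrt (2 * defect ρ g))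
    (sqrt_defect_mul_le ρ hρ) (fun c g => by rw [defect_conj]) (fun g => by rw [defect_inv ρ hρ])
    (by rw [defect_one, mul_zero, Real.sqrt_zero]) w.length w le_rfl hw
  refine ⟨P.length, fun k => (P[k.1]).1, fun k => (P[k.1]).2, hPlen, fun V x => ?_⟩
  have h1 := hP V x
  rw [← Fin.sum_univ_fun_getElem] at h1
  dsimp only
  -- abbreviate the plaquette deficits
  set d : Fin P.length → ℝ := fun k =>
    defect ρ (plaquetteHolonomy V (x + (P[k.1]).1) (P[k.1]).2.1 (P[k.1]).2.2) with hd
  have hdnn : ∀ k, 0 ≤ d k := fun k => defect_nonneg ρ hρ _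
  have h0 : 0 ≤ defect ρ (hol V x w) := defect_nonneg ρ hρ _
  have h1' : Real.sqrt (2 * defect ρ (hol V x w)) ≤ ∑ k, Real.sqrt (2 * d k) := h1
  have h2 : 2 * defect ρ (hol V x w) ≤ P.length * ∑ k, 2 * d k := by
    calc 2 * defect ρ (hol V x w) = (Real.sqrt (2 * defect ρ (hol V x w))) ^ 2 := by
          rw [Real.sq_sqrt (by linarith)]
      _ ≤ (∑ k, Real.sqrt (2 * d k)) ^ 2 := pow_le_pow_left₀ (Real.sqrt_nonneg _) h1' 2
      _ ≤ (Finset.univ : Finset (Fin P.length)).card * ∑ k, (Real.sqrt (2 * d k)) ^ 2 :=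
          sq_sum_le_card_mul_sum_sq
      _ = P.length * ∑ k, 2 * d k := by
          rw [Finset.card_univ, Fintype.card_fin]
          congr 1
          refine Finset.sum_congr rfl fun k _ => ?_
          rw [Real.sq_sqrt (by linarith [hdnn k])]
  rw [← Finset.mul_sum] at h2
  have h3 : 0 ≤ (P.length : ℝ) * ∑ k, d k :=
    mul_nonneg (Nat.cast_nonneg _) (Finset.sum_nonneg fun k _ => hdnn k)
  linarith

/-! ## Plane actions and the Wilson action -/

variable [NeZero L]

/-- The Wilson action is nonnegative for unitary `ρ`. -/
theorem wilsonAction_nonneg' (V : GaugeConfig 4 L G) : 0 ≤ wilsonAction ρ V := by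
  unfold wilsonAction
  exact Finset.sum_nonneg fun p _ => defect_nonneg ρ hρ (plaquetteHolonomy V p.1 p.2.1.1 p.2.1.2)

omit hρ in
/-- The Wilson action as a double sum over base points and planes `μ < ν`. -/
theorem wilsonAction_eq_sum_sum (V : GaugeConfig 4 L G) :
    wilsonAction ρ V = ∑ x : TorusSite 4 L, ∑ q : {p : Fin 4 × Fin 4 // p.1 < p.2},
      defect ρ (plaquetteHolonomy V x q.1.1 q.1.2) := by
  unfold wilsonAction
  exact Fintype.sum_prod_type _

/-- A plane action with `μ < ν` is bounded by the full Wilson action. -/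
theorem planeDefect_le_wilsonAction_of_lt (V : GaugeConfig 4 L G) {μ ν : Fin 4} (h : μ < ν) :
    planeDefect ρ V μ ν ≤ wilsonAction ρ V := by
  rw [wilsonAction_eq_sum_sum]
  unfold planeDefect
  refine Finset.sum_le_sum fun x _ => ?_
  have key : ∀ g : {p : Fin 4 × Fin 4 // p.1 < p.2} → ℝ, (∀ q, 0 ≤ g q) →
      g ⟨(μ, ν), h⟩ ≤ ∑ q, g q :=
    fun g hg => Finset.single_le_sum (fun q _ => hg q) (Finset.mem_univ _)
  exact key (fun q => defect ρ (plaquetteHolonomy V x q.1.1 q.1.2)) fun q => defect_nonneg ρ hρ _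

/-- Every plane action is bounded by the full Wilson action (for any pair of directions). -/
theorem planeDefect_le_wilsonAction (V : GaugeConfig 4 L G) (μ ν : Fin 4) :
    planeDefect ρ V μ ν ≤ wilsonAction ρ V := by
  rcases lt_trichotomy μ ν with h | rfl | h
  · exact planeDefect_le_wilsonAction_of_lt ρ hρ V h
  · have h0 : planeDefect ρ V μ μ = 0 := by
      refine Finset.sum_eq_zero fun x _ => ?_
      have h1 : plaquetteHolonomy V x μ μ = 1 := by
        simp only [plaquetteHolonomy, mul_inv_cancel_right, mul_inv_cancel]
      rw [h1, defect_one]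
    rw [h0]
    exact wilsonAction_nonneg' ρ hρ V
  · have h0 : planeDefect ρ V μ ν = planeDefect ρ V ν μ := by
      refine Finset.sum_congr rfl fun x _ => ?_
      have hswap : plaquetteHolonomy V x μ ν = (plaquetteHolonomy V x ν μ)⁻¹ := by
        simp only [plaquetteHolonomy]
        group
      rw [hswap, defect_inv ρ hρ]
    rw [h0]
    exact planeDefect_le_wilsonAction_of_lt ρ hρ V h

/-- **The locality bound of the hopping expansion.**  For a balanced word `w` and unitary `ρ`:
`Σ_x (N - Re tr ρ(hol V x w)) ≤ |w|⁴ · S_W(V)`. -/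
theorem wordDefect_le (w : List Letter) (hw : balanced w = true) (V : GaugeConfig 4 L G) :
    wordDefect ρ V w ≤ (w.length : ℝ) ^ 4 * wilsonAction ρ V := by
  obtain ⟨K, o, pl, hK, hb⟩ := exists_defect_hol_le ρ hρ w hw
  have hS := wilsonAction_nonneg' ρ hρ V
  calc wordDefect ρ V w
      ≤ ∑ x : TorusSite 4 L, (K : ℝ) * ∑ k, defect ρ (plaquetteHolonomy V (x + o k) (pl k).1 (pl k).2) :=
        Finset.sum_le_sum fun x _ => hb V x
    _ = K * ∑ k, planeDefect ρ V (pl k).1 (pl k).2 := by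
        rw [← Finset.mul_sum, Finset.sum_comm]
        congr 1
        refine Finset.sum_congr rfl fun k _ => ?_
        exact Fintype.sum_equiv (Equiv.addRight (o k)) _ _ fun x => rfl
    _ ≤ K * ∑ _k : Fin K, wilsonAction ρ V := by
        apply mul_le_mul_of_nonneg_left _ (Nat.cast_nonneg K)
        exact Finset.sum_le_sum fun k _ => planeDefect_le_wilsonAction ρ hρ V _ _
    _ = (K : ℝ) ^ 2 * wilsonAction ρ V := by
        rw [Finset.sum_const, Finset.card_univ, Fintype.card_fin, nsmul_eq_mul]; ring
    _ ≤ (w.length : ℝ) ^ 4 * wilsonAction ρ V := by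
        apply mul_le_mul_of_nonneg_right _ hS
        have : (K : ℝ) ≤ (w.length : ℝ) ^ 2 := by exact_mod_cast hK
        calc (K : ℝ) ^ 2 ≤ ((w.length : ℝ) ^ 2) ^ 2 := pow_le_pow_left₀ (Nat.cast_nonneg K) this 2
          _ = (w.length : ℝ) ^ 4 := by ring

end Length

end Summit.QuantumFields.QCD.Theorems.SmallHopping
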